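import Summits.CriticalPhenomena.PercolationContinuityZ3.Theorems.Transplant.FKConnectivityAllQAntipodalAnd4Sides
import Summits.CriticalPhenomena.PercolationContinuityZ3.Theorems.Transplant.FKConnectivityAllQAntipodalAnd4Theta
import Summits.CriticalPhenomena.PercolationContinuityZ3.Theorems.Transplant.FKConnectivityAllQAntipodalAnd4ParallelMain
import HarnessLib

/-!
# Connectivity correlation inequalities for `φ_{w,q}`, every `q > 0` — file 30a: **`C_∞(and)` AT LEVEL 3 FOR THE 3-EDGE PATH ON EVERY
# 2-CONNECTED SERIES–PARALLEL GRAPH** (induction over the series–parallel structure of `H \ bc`, assembling the three junction theorems)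

Support file (`--supports stmt-CriticalPhenomena-4575`), FK sub-lane `prim-bschramm-fk-2` (gen 19) of the post-continuity programme; builds
on p205010 (kernel theorem, internal audit signed; external expert review pending).  No definitions, no named facts, no sorries; standard axioms.

THE RESULT.  Let `K` be a two-terminal series–parallel network between `b` and `c` containing two distinct edges `ab` and `cd` and not the
edge `bc`, and `H = K ∪ {bc}` (so `H` is an arbitrary 2-connected series–parallel graph presented from its edge `bc`, and `S = {ab, bc, cd} ⊆ H`
is an arbitrary 3-edge path / triangle through `bc`).  Then for every `0 < q ≤ 1` and every increasing `g` on the other edges: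
`apPsi q H 1_{S ⊆ ·} g ≤ 0` (**`FK.apPsi_and_path3_nonpos_of_isTTSP`**), i.e. every square-free coefficient of `Z_H² Cov_{φ_{z,q}}(ω_{ab} ω_{bc}
ω_{cd}, g)` is `≤ 0` — gen 10's Conjecture `C_∞` (FK-Q2 §20–27) for the AND type of three edges in a path, on the whole class where the
single-edge statement (Theorem U, gen 11) holds; the first level-3 case of `C_∞` beyond the triangle with a pendant-free proof... the triangle
(`a = d`) is included.  PROOF (`and_path3_drift_nonpos_of_isTTSP`, induction on the derivation of `K`): a series root `K = E₁(b,m) · E₂(m,c)`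
forces `ab ∈ E₁`, `cd ∈ E₂` and is file 27's SERIES junction (`and4_series_nonpos`) with the side inputs of file 30 (no condition on the
virtual edges `bm`, `mc`); a parallel root `K = E₁ ∥ E₂` with the end edges in different parts is file 28's PARALLEL junction
(`and4_parallel_nonpos`, inputs gen 11's |W| = 3 theorem and the `bc`-contracted Theorem U); with both end edges in one part `E₁` it is file
29's THETA junction (`and4_theta_nonpos`) whose inputs are the INDUCTION HYPOTHESIS for `E₁`, the contracted AND-drift on `E₁`
(`andc_side_nonpos`, valid for every TTSP network — this is what closes the induction) and Theorem U on `E₂`.  All three junction identities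
were found by linear programming over junction types and verified exactly before typing (memo `bschramm/FROM-fk-2-g18-AND-WORDHALL.md` §7A,
gen 19's memo); the induction needs no case analysis of SP trees beyond the constructors of `IsTTSP`.
[cite: Grimmett2006, §1.4 eq. (1.20) (p. 15); §3.8 Thm. (3.90) (pp. 61–62); §3.9 (pp. 63–64)] [cite: Wagner2006, Thm. 5.8(d), §5.3]
-/

noncomputable section

namespace Summit.CriticalPhenomena.PercolationContinuityZ3.Theorems

namespace FK

open SimpleGraph Literature.Probability.LatticeModels Literature.Probability.Percolation
open scoped Classical

variable {V : Type*} [Fintype V]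

section Path

omit [Fintype V] in
/-- Erasing an element absent from the right part of a union. [folklore] -/
theorem erase_union_of_notMem_right {X Y : Finset (Sym2 V)} {x : Sym2 V} (h : x ∉ Y) : (X ∪ Y).erase x = X.erase x ∪ Y := by
  ext e
  simp only [Finset.mem_erase, Finset.mem_union]
  constructor
  · rintro ⟨hne, h₁ | h₂⟩
    · exact Or.inl ⟨hne, h₁⟩
    · exact Or.inr h₂
  · rintro (⟨hne, h₁⟩ | h₂)
    · exact ⟨hne, Or.inl h₁⟩
    · exact ⟨fun hh => h (hh ▸ h₂), Or.inr h₂⟩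

omit [Fintype V] in
/-- Erasing an element absent from the left part of a union. [folklore] -/
theorem erase_union_of_notMem_left {X Y : Finset (Sym2 V)} {x : Sym2 V} (h : x ∉ X) : (X ∪ Y).erase x = X ∪ Y.erase x := by
  rw [Finset.union_comm, erase_union_of_notMem_right h, Finset.union_comm]

/-- **THE INDUCTION (AND-drift form).**  For every two-terminal series–parallel `K` between `b, c` with distinct edges `ab, cd ∈ K` and
`bc ∉ K`, and every `h` monotone on the subsets of `N = K \ {ab, cd}` (`0 < q ≤ 1`):
`∑_{γ ⊆ N} (q^{k(γ ∪ S) + k(N \ γ)} - q^{k((N \ γ) ∪ S) + k(γ)}) h(γ) ≤ 0`, `S = {ab, bc, cd}` — by induction on the derivation of `K`: series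
root ⇒ `and4_series_nonpos` (side inputs `and2_side_nonpos'`, `and1_side_nonpos'`); parallel root, end edges in different parts ⇒
`and4_parallel_nonpos` (side inputs `and2_side_nonpos`, `xi_side_nonneg`); parallel root, end edges in one part ⇒ `and4_theta_nonpos` with
the induction hypothesis, `andc_side_nonpos` and Theorem U on the other part.
[cite: Grimmett2006, §3.8 Thm. (3.90) (pp. 61–62); §3.9 (pp. 63–64)] [cite: Wagner2006, Thm. 5.8(d), §5.3] -/
theorem and_path3_drift_nonpos_of_isTTSP {q : ℝ} (hq0 : 0 < q) (hq1 : q ≤ 1) {K : Finset (Sym2 V)} {b c : V} (hK : IsTTSP K b c) :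
    ∀ {a d : V}, s(a, b) ∈ K → s(c, d) ∈ K → s(a, b) ≠ s(c, d) → s(b, c) ∉ K →
      ∀ h : Finset (Sym2 V) → ℝ, (∀ ⦃A B : Finset (Sym2 V)⦄, A ⊆ B → B ⊆ (K.erase s(a, b)).erase s(c, d) → h A ≤ h B) →
        ∑ γ ∈ ((K.erase s(a, b)).erase s(c, d)).powerset,
          (q ^ (clusterCount (↑(γ ∪ {s(a, b), s(b, c), s(c, d)}) : BondConfig V) ∅ +
                clusterCount (↑((K.erase s(a, b)).erase s(c, d) \ γ) : BondConfig V) ∅) -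
            q ^ (clusterCount (↑((K.erase s(a, b)).erase s(c, d) \ γ ∪ {s(a, b), s(b, c), s(c, d)}) : BondConfig V) ∅ +
                clusterCount (↑γ : BondConfig V) ∅)) * h γ ≤ 0 := by
  induction hK with
  | @edge b c hbc =>
    intro a d _ _ _ hbcK
    exact absurd (Finset.mem_singleton_self _) hbcK
  | @series E₁ E₂ b m c h₁ h₂ hd hV hb' hc' _ _ =>
    intro a d hab hcd hne hbcK h hmono
    -- the end edges sit in the two parts
    have hab₂ : s(a, b) ∉ E₂ := fun h' => hb' _ h' (Sym2.mem_mk_right a b)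
    have hcd₁ : s(c, d) ∉ E₁ := fun h' => hc' _ h' (Sym2.mem_mk_left c d)
    have hab₁ : s(a, b) ∈ E₁ := (Finset.mem_union.1 hab).resolve_right hab₂
    have hcd₂ : s(c, d) ∈ E₂ := (Finset.mem_union.1 hcd).resolve_left hcd₁
    have hN : ((E₁ ∪ E₂).erase s(a, b)).erase s(c, d) = E₁.erase s(a, b) ∪ E₂.erase s(c, d) := by
      rw [erase_union_of_notMem_right hab₂, erase_union_of_notMem_left (fun h' => hcd₁ (Finset.mem_of_mem_erase h'))]
    rw [hN] at hmono ⊢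
    have hA₁ : IsTTSP (insert s(a, b) (E₁.erase s(a, b))) b m := by rw [Finset.insert_erase hab₁]; exact h₁
    have hA₂ : IsTTSP (insert s(c, d) (E₂.erase s(c, d))) m c := by rw [Finset.insert_erase hcd₂]; exact h₂
    -- distinctness and vertex sets
    have hbm : b ≠ m := h₁.ne
    have hcm : c ≠ m := h₂.ne.symm
    have hbc : b ≠ c := by
      obtain ⟨e, he, hbe⟩ := h₁.left_mem
      intro hh; exact hc' e he (hh ▸ hbe)
    set V₁ : Set V := {z | ∃ e ∈ E₁, z ∈ e} with hV₁
    set V₂ : Set V := {z | ∃ e ∈ E₂, z ∈ e} with hV₂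
    have g₁ : ∀ e ∈ (↑E₁ : Set (Sym2 V)), ∀ z ∈ e, z ∈ V₁ := fun e he z hz => ⟨e, he, hz⟩
    have g₂ : ∀ e ∈ (↑E₂ : Set (Sym2 V)), ∀ z ∈ e, z ∈ V₂ := fun e he z hz => ⟨e, he, hz⟩
    have hS : V₁ ∩ V₂ ⊆ ({m} : Set V) := fun z hz => hV z hz.1 hz.2
    have hbV₂ : b ∉ V₂ := fun ⟨e, he, hbe⟩ => hb' e he hbe
    have hcV₁ : c ∉ V₁ := fun ⟨e, he, hce⟩ => hc' e he hce
    have hdN : Disjoint (E₁.erase s(a, b)) (E₂.erase s(c, d)) :=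
      Finset.disjoint_of_subset_left (Finset.erase_subset _ _) (Finset.disjoint_of_subset_right (Finset.erase_subset _ _) hd)
    -- ambient networks for the single-edge inputs (Duffin)
    have hEa : IsTTSP (insert s(b, m) E₁) a b := h₁.insert_edge_of_mem (Finset.mem_insert_of_mem hab₁)
    have hEd : IsTTSP (insert s(m, c) E₂) c d := h₂.insert_edge_of_mem (Finset.mem_insert_of_mem hcd₂)
    have hn₁ : s(a, b) ∉ E₁.erase s(a, b) := Finset.notMem_erase s(a, b) E₁
    have hn₂ : s(c, d) ∉ E₂.erase s(c, d) := Finset.notMem_erase s(c, d) E₂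
    have hs₁ : E₁.erase s(a, b) ⊆ insert s(b, m) E₁ := (Finset.erase_subset s(a, b) E₁).trans (Finset.subset_insert s(b, m) E₁)
    have hs₂ : E₂.erase s(c, d) ⊆ insert s(m, c) E₂ := (Finset.erase_subset s(c, d) E₂).trans (Finset.subset_insert s(m, c) E₂)
    have hY₁ : ∀ h' : Finset (Sym2 V) → ℝ, (∀ ⦃A B : Finset (Sym2 V)⦄, A ⊆ B → B ⊆ E₁.erase s(a, b) → h' A ≤ h' B) →
        ∑ γ₁ ∈ (E₁.erase s(a, b)).powerset, (q ^ (clusterCount (↑(insert s(b, m) (insert s(a, b) γ₁)) : BondConfig V) ∅ +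
            clusterCount (↑(E₁.erase s(a, b) \ γ₁) : BondConfig V) ∅) -
          q ^ (clusterCount (↑(insert s(b, m) (insert s(a, b) (E₁.erase s(a, b) \ γ₁))) : BondConfig V) ∅ +
            clusterCount (↑γ₁ : BondConfig V) ∅)) * h' γ₁ ≤ 0 :=
      fun h' hm => and2_side_nonpos' hq0 hq1 hA₁ hn₁ hm
    have hU₁ : ∀ h' : Finset (Sym2 V) → ℝ, (∀ ⦃A B : Finset (Sym2 V)⦄, A ⊆ B → B ⊆ E₁.erase s(a, b) → h' A ≤ h' B) →
        ∑ γ₁ ∈ (E₁.erase s(a, b)).powerset, (q ^ (clusterCount (↑(insert s(a, b) γ₁) : BondConfig V) ∅ +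
            clusterCount (↑(E₁.erase s(a, b) \ γ₁) : BondConfig V) ∅) -
          q ^ (clusterCount (↑(insert s(a, b) (E₁.erase s(a, b) \ γ₁)) : BondConfig V) ∅ +
            clusterCount (↑γ₁ : BondConfig V) ∅)) * h' γ₁ ≤ 0 :=
      fun h' hm => and1_side_nonpos' hq0 hq1 hEa hs₁ hn₁ hm
    have hY₂ : ∀ h' : Finset (Sym2 V) → ℝ, (∀ ⦃A B : Finset (Sym2 V)⦄, A ⊆ B → B ⊆ E₂.erase s(c, d) → h' A ≤ h' B) →
        ∑ γ₂ ∈ (E₂.erase s(c, d)).powerset, (q ^ (clusterCount (↑(insert s(m, c) (insert s(c, d) γ₂)) : BondConfig V) ∅ +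
            clusterCount (↑(E₂.erase s(c, d) \ γ₂) : BondConfig V) ∅) -
          q ^ (clusterCount (↑(insert s(m, c) (insert s(c, d) (E₂.erase s(c, d) \ γ₂))) : BondConfig V) ∅ +
            clusterCount (↑γ₂ : BondConfig V) ∅)) * h' γ₂ ≤ 0 :=
      fun h' hm => and2_side_nonpos' hq0 hq1 hA₂ hn₂ hm
    have hU₂ : ∀ h' : Finset (Sym2 V) → ℝ, (∀ ⦃A B : Finset (Sym2 V)⦄, A ⊆ B → B ⊆ E₂.erase s(c, d) → h' A ≤ h' B) →
        ∑ γ₂ ∈ (E₂.erase s(c, d)).powerset, (q ^ (clusterCount (↑(insert s(c, d) γ₂) : BondConfig V) ∅ +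
            clusterCount (↑(E₂.erase s(c, d) \ γ₂) : BondConfig V) ∅) -
          q ^ (clusterCount (↑(insert s(c, d) (E₂.erase s(c, d) \ γ₂)) : BondConfig V) ∅ +
            clusterCount (↑γ₂ : BondConfig V) ∅)) * h' γ₂ ≤ 0 :=
      fun h' hm => and1_side_nonpos' hq0 hq1 hEd hs₂ hn₂ hm
    exact and4_series_nonpos hq0 g₁ g₂ hS hbV₂ hcV₁ hbm hcm hbc hab₁ hcd₂ hdN (Finset.erase_subset s(a, b) E₁)
      (Finset.erase_subset s(c, d) E₂) hY₁ hU₁ hY₂ hU₂ hmono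
  | @parallel E₁ E₂ b c h₁ h₂ hd hV ih₁ ih₂ =>
    intro a d hab hcd hne hbcK h hmono
    have hbc : b ≠ c := h₁.ne
    have hbc₁ : s(b, c) ∉ E₁ := fun h' => hbcK (Finset.mem_union_left _ h')
    have hbc₂ : s(b, c) ∉ E₂ := fun h' => hbcK (Finset.mem_union_right _ h')
    set V₁ : Set V := {z | ∃ e ∈ E₁, z ∈ e} with hV₁
    set V₂ : Set V := {z | ∃ e ∈ E₂, z ∈ e} with hV₂
    have g₁ : ∀ e ∈ (↑E₁ : Set (Sym2 V)), ∀ z ∈ e, z ∈ V₁ := fun e he z hz => ⟨e, he, hz⟩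
    have g₂ : ∀ e ∈ (↑E₂ : Set (Sym2 V)), ∀ z ∈ e, z ∈ V₂ := fun e he z hz => ⟨e, he, hz⟩
    have hS : V₁ ∩ V₂ ⊆ ({b, c} : Set V) := by
      intro z hz
      rcases hV z hz.1 hz.2 with h' | h'
      · exact Or.inl h'
      · exact Or.inr h'
    have hS' : V₂ ∩ V₁ ⊆ ({b, c} : Set V) := fun z hz => hS ⟨hz.2, hz.1⟩
    -- the theta case, for either part
    have theta : ∀ {F R : Finset (Sym2 V)} {W₁ W₂ : Set V}, IsTTSP F b c → IsTTSP R b c → Disjoint F R →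
        (∀ e ∈ (↑F : Set (Sym2 V)), ∀ z ∈ e, z ∈ W₁) → (∀ e ∈ (↑R : Set (Sym2 V)), ∀ z ∈ e, z ∈ W₂) → W₁ ∩ W₂ ⊆ ({b, c} : Set V) →
        s(a, b) ∈ F → s(c, d) ∈ F → s(b, c) ∉ F →
        (∀ h' : Finset (Sym2 V) → ℝ, (∀ ⦃A B : Finset (Sym2 V)⦄, A ⊆ B → B ⊆ (F.erase s(a, b)).erase s(c, d) → h' A ≤ h' B) →
          ∑ γ ∈ ((F.erase s(a, b)).erase s(c, d)).powerset,
            (q ^ (clusterCount (↑(γ ∪ {s(a, b), s(b, c), s(c, d)}) : BondConfig V) ∅ +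
                  clusterCount (↑((F.erase s(a, b)).erase s(c, d) \ γ) : BondConfig V) ∅) -
              q ^ (clusterCount (↑((F.erase s(a, b)).erase s(c, d) \ γ ∪ {s(a, b), s(b, c), s(c, d)}) : BondConfig V) ∅ +
                  clusterCount (↑γ : BondConfig V) ∅)) * h' γ ≤ 0) →
        ∀ h' : Finset (Sym2 V) → ℝ, (∀ ⦃A B : Finset (Sym2 V)⦄, A ⊆ B → B ⊆ (F.erase s(a, b)).erase s(c, d) ∪ R → h' A ≤ h' B) →
          ∑ γ ∈ ((F.erase s(a, b)).erase s(c, d) ∪ R).powerset,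
            (q ^ (clusterCount (↑(γ ∪ {s(a, b), s(b, c), s(c, d)}) : BondConfig V) ∅ +
                  clusterCount (↑(((F.erase s(a, b)).erase s(c, d) ∪ R) \ γ) : BondConfig V) ∅) -
              q ^ (clusterCount (↑(((F.erase s(a, b)).erase s(c, d) ∪ R) \ γ ∪ {s(a, b), s(b, c), s(c, d)}) : BondConfig V) ∅ +
                  clusterCount (↑γ : BondConfig V) ∅)) * h' γ ≤ 0 := by
      intro F R W₁ W₂ hF hR hdFR k₁ k₂ kS habF hcdF hbcF ih h' hm
      set M := (F.erase s(a, b)).erase s(c, d) with hM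
      have hcdF' : s(c, d) ∈ F.erase s(a, b) := Finset.mem_erase.2 ⟨hne.symm, hcdF⟩
      have hKM : insert s(a, b) (insert s(c, d) M) = F := by
        rw [hM, Finset.insert_erase hcdF', Finset.insert_erase habF]
      have hKF : IsTTSP (insert s(a, b) (insert s(c, d) M)) b c := by rw [hKM]; exact hF
      have habM : s(a, b) ∉ M := fun hh => Finset.notMem_erase _ _ (Finset.mem_of_mem_erase hh)
      have hcdM : s(c, d) ∉ M := Finset.notMem_erase _ _
      have hbcKM : s(b, c) ∉ insert s(a, b) (insert s(c, d) M) := by rw [hKM]; exact hbcF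
      have hMF : M ⊆ F := (Finset.erase_subset _ _).trans (Finset.erase_subset _ _)
      -- ambient set of the `M`-side: `F ∪ {bc}`
      set W₁' : Set V := {z | ∃ e ∈ insert s(b, c) F, z ∈ e} with hW₁'
      have k₁' : ∀ e ∈ (↑(insert s(b, c) F) : Set (Sym2 V)), ∀ z ∈ e, z ∈ W₁' := fun e he z hz => ⟨e, he, hz⟩
      have kS' : W₁' ∩ W₂ ⊆ ({b, c} : Set V) := by
        rintro z ⟨⟨e, he, hze⟩, hz₂⟩
        rcases Finset.mem_insert.1 he with rfl | he
        · rcases Sym2.mem_iff.1 hze with rfl | rfl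
          · exact Or.inl rfl
          · exact Or.inr rfl
        · exact kS ⟨k₁ e he z hze, hz₂⟩
      have kSE : ({s(a, b), s(b, c), s(c, d)} : Finset (Sym2 V)) ⊆ insert s(b, c) F := by
        intro e he
        simp only [Finset.mem_insert, Finset.mem_singleton] at he
        rcases he with rfl | rfl | rfl
        · exact Finset.mem_insert_of_mem habF
        · exact Finset.mem_insert_self _ _
        · exact Finset.mem_insert_of_mem hcdF
      have hdMR : Disjoint M R := Finset.disjoint_of_subset_left hMF hdFR
      exact and4_theta_nonpos hq0 hq1 k₁' k₂ kS' hbc kSE hdMR (hMF.trans (Finset.subset_insert _ _)) le_rfl ih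
        (fun h'' hm'' => andc_side_nonpos hq0 hq1 hKF habM hcdM hne hbcKM hm'')
        (fun h'' hm'' => apUpc_nonneg_of_isTTSP hq0 hR R le_rfl h'' hm'') hm
    -- the parallel case, for either orientation
    have par : ∀ {F₁ F₂ : Finset (Sym2 V)} {W₁ W₂ : Set V}, IsTTSP F₁ b c → IsTTSP F₂ b c → Disjoint F₁ F₂ →
        (∀ e ∈ (↑F₁ : Set (Sym2 V)), ∀ z ∈ e, z ∈ W₁) → (∀ e ∈ (↑F₂ : Set (Sym2 V)), ∀ z ∈ e, z ∈ W₂) → W₁ ∩ W₂ ⊆ ({b, c} : Set V) →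
        s(a, b) ∈ F₁ → s(c, d) ∈ F₂ → s(b, c) ∉ F₁ → s(b, c) ∉ F₂ →
        ∀ h' : Finset (Sym2 V) → ℝ, (∀ ⦃A B : Finset (Sym2 V)⦄, A ⊆ B → B ⊆ F₁.erase s(a, b) ∪ F₂.erase s(c, d) → h' A ≤ h' B) →
          ∑ γ ∈ (F₁.erase s(a, b) ∪ F₂.erase s(c, d)).powerset,
            (q ^ (clusterCount (↑(γ ∪ {s(a, b), s(b, c), s(c, d)}) : BondConfig V) ∅ +
                  clusterCount (↑((F₁.erase s(a, b) ∪ F₂.erase s(c, d)) \ γ) : BondConfig V) ∅) -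
              q ^ (clusterCount (↑((F₁.erase s(a, b) ∪ F₂.erase s(c, d)) \ γ ∪ {s(a, b), s(b, c), s(c, d)}) : BondConfig V) ∅ +
                  clusterCount (↑γ : BondConfig V) ∅)) * h' γ ≤ 0 := by
      intro F₁ F₂ W₁ W₂ hF₁ hF₂ hd₁₂ k₁ k₂ kS habF hcdF hbcF₁ hbcF₂ h' hm
      have hA₁ : IsTTSP (insert s(a, b) (F₁.erase s(a, b))) b c := by rw [Finset.insert_erase habF]; exact hF₁
      have hA₂ : IsTTSP (insert s(c, d) (F₂.erase s(c, d))) b c := by rw [Finset.insert_erase hcdF]; exact hF₂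
      have hbcA₁ : s(b, c) ∉ insert s(a, b) (F₁.erase s(a, b)) := by rw [Finset.insert_erase habF]; exact hbcF₁
      have hbcA₂ : s(b, c) ∉ insert s(c, d) (F₂.erase s(c, d)) := by rw [Finset.insert_erase hcdF]; exact hbcF₂
      have hn₁ : s(a, b) ∉ F₁.erase s(a, b) := Finset.notMem_erase _ _
      have hn₂ : s(c, d) ∉ F₂.erase s(c, d) := Finset.notMem_erase _ _
      have hdN : Disjoint (F₁.erase s(a, b)) (F₂.erase s(c, d)) :=
        Finset.disjoint_of_subset_left (Finset.erase_subset _ _) (Finset.disjoint_of_subset_right (Finset.erase_subset _ _) hd₁₂)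
      refine and4_parallel_nonpos hq0 hq1 k₁ k₂ kS hbc habF hcdF hdN (Finset.erase_subset s(a, b) F₁) (Finset.erase_subset s(c, d) F₂)
        ?_ ?_ ?_ ?_ hm
      · intro h'' hm''
        have key := and2_side_nonpos hq0 hq1 hA₁ hbcA₁ (Finset.mem_insert_self _ _) (h := h'')
          (by rw [Finset.erase_insert hn₁]; exact hm'')
        rwa [Finset.erase_insert hn₁] at key
      · intro h'' hm''
        have key := xi_side_nonneg hq0 hA₁ hbcA₁ (Finset.mem_insert_self _ _) (h := h'')
          (by rw [Finset.erase_insert hn₁]; exact hm'')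
        rwa [Finset.erase_insert hn₁] at key
      · intro h'' hm''
        have key := and2_side_nonpos hq0 hq1 hA₂ hbcA₂ (Finset.mem_insert_self _ _) (h := h'')
          (by rw [Finset.erase_insert hn₂]; exact hm'')
        rwa [Finset.erase_insert hn₂] at key
      · intro h'' hm''
        have key := xi_side_nonneg hq0 hA₂ hbcA₂ (Finset.mem_insert_self _ _) (h := h'')
          (by rw [Finset.erase_insert hn₂]; exact hm'')
        rwa [Finset.erase_insert hn₂] at key
    -- where are the end edges?
    rcases Finset.mem_union.1 hab with hab₁ | hab₂ <;> rcases Finset.mem_union.1 hcd with hcd₁ | hcd₂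
    · -- both in `E₁`: theta with `R = E₂`
      have hab₂ : s(a, b) ∉ E₂ := Finset.disjoint_left.1 hd hab₁
      have hcd₂ : s(c, d) ∉ E₂ := Finset.disjoint_left.1 hd hcd₁
      have hN : ((E₁ ∪ E₂).erase s(a, b)).erase s(c, d) = (E₁.erase s(a, b)).erase s(c, d) ∪ E₂ := by
        rw [erase_union_of_notMem_right hab₂, erase_union_of_notMem_right hcd₂]
      rw [hN] at hmono ⊢
      exact theta h₁ h₂ hd g₁ g₂ hS hab₁ hcd₁ hbc₁ (fun h' hm => ih₁ hab₁ hcd₁ hne hbc₁ h' hm) h hmono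
    · -- `ab ∈ E₁`, `cd ∈ E₂`: parallel
      have hab₂ : s(a, b) ∉ E₂ := Finset.disjoint_left.1 hd hab₁
      have hcd₁ : s(c, d) ∉ E₁ := Finset.disjoint_right.1 hd hcd₂
      have hN : ((E₁ ∪ E₂).erase s(a, b)).erase s(c, d) = E₁.erase s(a, b) ∪ E₂.erase s(c, d) := by
        rw [erase_union_of_notMem_right hab₂, erase_union_of_notMem_left (fun h' => hcd₁ (Finset.mem_of_mem_erase h'))]
      rw [hN] at hmono ⊢
      exact par h₁ h₂ hd g₁ g₂ hS hab₁ hcd₂ hbc₁ hbc₂ h hmono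
    · -- `ab ∈ E₂`, `cd ∈ E₁`: parallel, mirrored
      have hab₁ : s(a, b) ∉ E₁ := Finset.disjoint_right.1 hd hab₂
      have hcd₂ : s(c, d) ∉ E₂ := Finset.disjoint_left.1 hd hcd₁
      have hN : ((E₁ ∪ E₂).erase s(a, b)).erase s(c, d) = E₂.erase s(a, b) ∪ E₁.erase s(c, d) := by
        rw [erase_union_of_notMem_left hab₁, erase_union_of_notMem_right (fun h' => hcd₂ (Finset.mem_of_mem_erase h')),
          Finset.union_comm]
      rw [hN] at hmono ⊢
      exact par h₂ h₁ hd.symm g₂ g₁ hS' hab₂ hcd₁ hbc₂ hbc₁ h hmono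
    · -- both in `E₂`: theta with `R = E₁`
      have hab₁ : s(a, b) ∉ E₁ := Finset.disjoint_right.1 hd hab₂
      have hcd₁ : s(c, d) ∉ E₁ := Finset.disjoint_right.1 hd hcd₂
      have hN : ((E₁ ∪ E₂).erase s(a, b)).erase s(c, d) = (E₂.erase s(a, b)).erase s(c, d) ∪ E₁ := by
        rw [erase_union_of_notMem_left hab₁, erase_union_of_notMem_left hcd₁, Finset.union_comm]
      rw [hN] at hmono ⊢
      exact theta h₂ h₁ hd.symm g₂ g₁ hS' hab₂ hcd₂ hbc₂ (fun h' hm => ih₂ hab₂ hcd₂ hne hbc₂ h' hm) h hmono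

omit [Fintype V] in
/-- The AND configuration: `(K \ {ab, cd}) ∪ {ab, bc, cd} = K ∪ {bc}` for `ab, cd ∈ K`. [folklore] -/
theorem erase_erase_union_path3_eq {K : Finset (Sym2 V)} {a b c d : V} (hab : s(a, b) ∈ K) (hcd : s(c, d) ∈ K) :
    (K.erase s(a, b)).erase s(c, d) ∪ {s(a, b), s(b, c), s(c, d)} = insert s(b, c) K := by
  ext e
  simp only [Finset.mem_union, Finset.mem_erase, Finset.mem_insert, Finset.mem_singleton]
  constructor
  · rintro (⟨_, _, he⟩ | rfl | rfl | rfl)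
    · exact Or.inr he
    · exact Or.inr hab
    · exact Or.inl rfl
    · exact Or.inr hcd
  · rintro (rfl | he)
    · exact Or.inr (Or.inr (Or.inl rfl))
    · by_cases h1 : e = s(a, b)
      · exact Or.inr (Or.inl h1)
      · by_cases h2 : e = s(c, d)
        · exact Or.inr (Or.inr (Or.inr h2))
        · exact Or.inl ⟨h2, h1, he⟩

/-- **THEOREM (`C_∞` at level 3 for the 3-edge path on every 2-connected series–parallel graph).**  Let `K` be a two-terminal series–parallel
network between `b` and `c` containing the distinct edges `ab` and `cd` and not containing `bc`, and let `H = K ∪ {bc}` — an arbitrary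
2-connected series–parallel graph presented from its edge `bc` (Duffin), `S = {ab, bc, cd} ⊆ H` an arbitrary 3-edge path through the middle
edge `bc` (or a triangle, `a = d`).  Then for every `0 < q ≤ 1` and every `g` increasing on the subsets of `K \ {ab, cd}` and not reading `S`:
`apPsi q H 1_{S ⊆ ·} g = ∑_{γ ⊆ H} q^{k(γ)+k(H\γ)} (1_S(γ) - 1_S(H\γ)) (g(γ) - g(H\γ)) ≤ 0`, i.e. EVERY square-free coefficient of
`Z_H(z)² · Cov_{φ_{z,q}}(ω_{ab} ω_{bc} ω_{cd}, g)` is `≤ 0` — gen 10's Conjecture `C_∞` (the coefficientwise negative dependence of FK-Q2 §20)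
for the AND type on a 3-edge path, on the full class of series–parallel supports (for `K₄` already the single-edge statement fails).
Proof: the bridge `apPsi_andInd_eq` and `and_path3_drift_nonpos_of_isTTSP`.
[cite: Grimmett2006, §3.8 Thm. (3.90) (pp. 61–62); §3.9 (pp. 63–64)] [cite: Wagner2006, Thm. 5.8(d), §5.3] -/
theorem apPsi_and_path3_nonpos_of_isTTSP {q : ℝ} (hq0 : 0 < q) (hq1 : q ≤ 1) {K : Finset (Sym2 V)} {a b c d : V}
    (hK : IsTTSP K b c) (hab : s(a, b) ∈ K) (hcd : s(c, d) ∈ K) (hne : s(a, b) ≠ s(c, d)) (hbc : s(b, c) ∉ K)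
    {g : Finset (Sym2 V) → ℝ} (hg : ∀ A T : Finset (Sym2 V), T ⊆ {s(a, b), s(b, c), s(c, d)} → g (A ∪ T) = g A)
    (hmono : ∀ ⦃A B : Finset (Sym2 V)⦄, A ⊆ B → B ⊆ (K.erase s(a, b)).erase s(c, d) → g A ≤ g B) :
    apPsi q (insert s(b, c) K) (fun X => if ({s(a, b), s(b, c), s(c, d)} : Finset (Sym2 V)) ⊆ X then 1 else 0) g ≤ 0 := by
  have hNS : Disjoint ((K.erase s(a, b)).erase s(c, d)) ({s(a, b), s(b, c), s(c, d)} : Finset (Sym2 V)) := by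
    refine Finset.disjoint_left.2 fun e he heS => ?_
    simp only [Finset.mem_insert, Finset.mem_singleton] at heS
    rcases heS with rfl | rfl | rfl
    · exact Finset.notMem_erase _ _ (Finset.mem_of_mem_erase he)
    · exact hbc (Finset.mem_of_mem_erase (Finset.mem_of_mem_erase he))
    · exact Finset.notMem_erase _ _ he
  rw [← erase_erase_union_path3_eq hab hcd, apPsi_andInd_eq q hNS ⟨s(a, b), Finset.mem_insert_self _ _⟩ hg]
  have main := and_path3_drift_nonpos_of_isTTSP hq0 hq1 hK hab hcd hne hbc g hmono
  linarith

end Path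

end FK

end Summit.CriticalPhenomena.PercolationContinuityZ3.Theorems

end
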